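import Mathlib

/-!
# Inverse displacement (Kailath–Kung–Morf push-through identity)

For square complex matrices we prove:

* `hclR_rank_one_sub_mul_comm` : `rank (1 - X * Y) = rank (1 - Y * X)` (push-through).
  Proof: by rank–nullity it suffices to compare kernels; `w ↦ X *ᵥ w` maps
  `ker (1 - Y * X)` injectively into `ker (1 - X * Y)` (if `w = Y X w` and `X w = X w'` then
  `w = Y (X w) = Y (X w') = w'`), and symmetrically.
* `hclR_rank_inv_displacement` : for invertible `A`, the Stein displacement rank of `A⁻¹` with
  respect to the swapped operator pair equals that of `A`:
  `rank (A⁻¹ - Q * A⁻¹ * P) = rank (A - P * A * Q)`.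
  Proof: `A - P A Q = A (1 - (A⁻¹ P)(A Q))` and `A⁻¹ - Q A⁻¹ P = A⁻¹ (1 - (A Q)(A⁻¹ P))`;
  left multiplication by an invertible matrix preserves rank, then push-through.
* `hclR_inv_displacement_le` : the corollary for the lower shift `Z` and its transpose:
  displacement rank `≤ d` of `A` w.r.t. `(Z, Zᵀ)` gives displacement rank `≤ d` of `A⁻¹`
  w.r.t. `(Zᵀ, Z)`.
-/

set_option linter.dupNamespace false

namespace Summit.MatrixMultiplication.MatrixMultiplication.Theorems

open scoped Matrix

/-- The map `w ↦ X *ᵥ w` sends `ker (1 - Y * X)` injectively into `ker (1 - X * Y)`, whence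
`finrank (ker (1 - Y * X)) ≤ finrank (ker (1 - X * Y))`. -/
private lemma hclR_finrank_ker_one_sub_mul_le {N : ℕ} (X Y : Matrix (Fin N) (Fin N) ℂ) :
    Module.finrank ℂ (LinearMap.ker (1 - Y * X).mulVecLin) ≤
      Module.finrank ℂ (LinearMap.ker (1 - X * Y).mulVecLin) := by
  have hmem : ∀ (U V : Matrix (Fin N) (Fin N) ℂ) (w : Fin N → ℂ),
      w ∈ LinearMap.ker (1 - U * V).mulVecLin ↔ w = U *ᵥ (V *ᵥ w) := by
    intro U V w
    simp only [LinearMap.mem_ker, Matrix.mulVecLin_apply, Matrix.sub_mulVec, Matrix.one_mulVec,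
      ← Matrix.mulVec_mulVec, sub_eq_zero]
  have hmap : ∀ w : LinearMap.ker (1 - Y * X).mulVecLin,
      (X.mulVecLin.comp (LinearMap.ker (1 - Y * X).mulVecLin).subtype) w ∈
        LinearMap.ker (1 - X * Y).mulVecLin := by
    rintro ⟨w, hw⟩
    rw [hmem] at hw
    rw [hmem]
    simp only [LinearMap.coe_comp, Submodule.coe_subtype, Function.comp_apply,
      Matrix.mulVecLin_apply]
    conv_lhs => rw [hw]
  refine LinearMap.finrank_le_finrank_of_injective
    (f := (X.mulVecLin.comp (LinearMap.ker (1 - Y * X).mulVecLin).subtype).codRestrict _ hmap) ?_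
  rintro ⟨w, hw⟩ ⟨w', hw'⟩ h
  have h' : X *ᵥ w = X *ᵥ w' := by
    simpa only [LinearMap.codRestrict_apply, LinearMap.coe_comp, Submodule.coe_subtype,
      Function.comp_apply, Matrix.mulVecLin_apply, Subtype.mk.injEq] using congrArg Subtype.val h
  rw [hmem] at hw hw'
  ext1
  calc w = Y *ᵥ (X *ᵥ w) := hw
    _ = Y *ᵥ (X *ᵥ w') := by rw [h']
    _ = w' := hw'.symm

/-- push-through: rank (1 - X*Y) = rank (1 - Y*X). -/
theorem hclR_rank_one_sub_mul_comm {N : ℕ} (X Y : Matrix (Fin N) (Fin N) ℂ) :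
    (1 - X * Y).rank = (1 - Y * X).rank := by
  have h1 := LinearMap.finrank_range_add_finrank_ker (1 - X * Y).mulVecLin
  have h2 := LinearMap.finrank_range_add_finrank_ker (1 - Y * X).mulVecLin
  have h3 := hclR_finrank_ker_one_sub_mul_le X Y
  have h4 := hclR_finrank_ker_one_sub_mul_le Y X
  unfold Matrix.rank
  omega

/-- KKM: the Stein displacement rank of the inverse w.r.t. the swapped operator pair equals that of the matrix. -/
theorem hclR_rank_inv_displacement {N : ℕ} (A P Q : Matrix (Fin N) (Fin N) ℂ) (hA : IsUnit A.det) :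
    (A⁻¹ - Q * A⁻¹ * P).rank = (A - P * A * Q).rank := by
  have e1 : A - P * A * Q = A * (1 - (A⁻¹ * P) * (A * Q)) := by
    simp only [Matrix.mul_sub, Matrix.mul_one, ← Matrix.mul_assoc, Matrix.mul_nonsing_inv A hA,
      Matrix.one_mul]
  have e2 : A⁻¹ - Q * A⁻¹ * P = A⁻¹ * (1 - (A * Q) * (A⁻¹ * P)) := by
    simp only [Matrix.mul_sub, Matrix.mul_one, ← Matrix.mul_assoc, Matrix.nonsing_inv_mul A hA,
      Matrix.one_mul]
  rw [e1, e2, Matrix.rank_mul_eq_right_of_isUnit_det A _ hA,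
    Matrix.rank_mul_eq_right_of_isUnit_det A⁻¹ _ (Matrix.isUnit_nonsing_inv_det A hA),
    hclR_rank_one_sub_mul_comm]

/-- Corollary used by the crux line: displacement rank ≤ d of A w.r.t. (Z, Zᵀ) gives displacement rank ≤ d of A⁻¹ w.r.t. (Zᵀ, Z). -/
theorem hclR_inv_displacement_le {N d : ℕ} (A : Matrix (Fin N) (Fin N) ℂ) (hA : IsUnit A.det)
    (h : (A - (Matrix.of fun i j : Fin N => if (i : ℕ) = (j : ℕ) + 1 then (1 : ℂ) else 0) * A *
      (Matrix.of fun i j : Fin N => if (i : ℕ) = (j : ℕ) + 1 then (1 : ℂ) else 0)ᵀ).rank ≤ d) :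
    (A⁻¹ - (Matrix.of fun i j : Fin N => if (i : ℕ) = (j : ℕ) + 1 then (1 : ℂ) else 0)ᵀ * A⁻¹ *
      (Matrix.of fun i j : Fin N => if (i : ℕ) = (j : ℕ) + 1 then (1 : ℂ) else 0)).rank ≤ d :=
  (hclR_rank_inv_displacement A _ _ hA).trans_le h

end Summit.MatrixMultiplication.MatrixMultiplication.Theorems
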